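import Mathlib
import HarnessLib
import Summits.QuantumAdvantage.QuantumAdvantage.Theses.TwoAdicStationaryPhase

/-!
# Line `birth` — BC3 skeleton for the crux `TspSignInPrBPP` (stmt-QuantumAdvantage-2646)

Route `TwoAdicStationaryPhase` (route-QuantumAdvantage-TwoAdicStationaryPhase; REFUTATION side, the deciding
theorem of the route file is `closes (h₁ : TspSignInPrBPP) (h₂ : TspSignHard) : ¬ QuantumAdvantage`), crux (rank 2,
the ISLAND, expected TRUE):

  `TspSignInPrBPP := POLYSIGN ∈ PromiseBPP'`,

where POLYSIGN is the one-register promise problem of the route file: instance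
`I = (c, x, y, P₀, [P₁, …, P_k]) : ℕ × ℕ × ℕ × List ℕ × List (List ℕ)` (`c` in UNARY, kicks as coefficient lists),
amplitude `A(I) = (2^c)^{-(k+1)} Σ_{v ∈ (ℤ/4^c)^k} e(Φ(v)/4^c)`, `Φ(v) = Σ_{i ≤ k} P_i(w_i) + w_i w_{i+1}`,
`w = (x, v, y)`; YES: `1/3 ≤ Re A`, NO: `Re A ≤ -1/3`; `PromiseBPP'` = textbook promise-BPP (Goldreich 2006 Def. 1.2).

## The line (the route's own plan 2650 → 2651 → 2647 → 2646, cut along the mathematics / algorithm seam)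

* `stub_henonAverage` (number theory, M–L; TRUE on paper and numerically): for all `c k P x y` the normalised chain
  sum is an exact AVERAGE over the first path variable, `A = 2^{-c} Σ_{s ∈ ℤ/2^c} f(s)`, where
  `f(s) = henonTerm s := [the Hénon chain from a₀ = s closes and starts at s] · e(Φ(ã(s))/4^c) ∈ {0} ∪ U(1)` and the
  chain `ã(s)` is given by the EXPLICIT recurrence `W'_0 = x, W'_1 = s, W'_{n+2} = -W'_n - P'_{n+1}(W'_{n+1})`
  (mod `2^c`; `a_i = W'_{i+1}`; least-residue lifts). Proof route: the route's support items
  `TspChainLocalisation` (= Dąbrowski–Fisher 1997 Thm 1.8(a) at `p = 2`, `m = 2c`, vendored and PROVED in the tree as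
  `Literature.NumberTheory.GaussSums.DabrowskiFisher1997_even_holds`) ÷ `(2^c)^{k+1}` = `TspAmplitudeAverage` (i):
  `A = 2^{-c} Σ_{a critical} e(Φ(ã)/4^c)`; then re-index the critical `a` by `s = a₀`: a critical `a` satisfies the
  recurrence, so `a = chain (a 0)` (`TspChainInjective` in constructive form), i.e. `Σ_{a critical} = Σ_s henonTerm s`
  (`Finset.sum_bij`); for `k = 0` the guard `headD (chain s) = s` reads `s = 0` and both sides are the single term
  `e(Φ/4^c)`. Numerically re-verified by this seat for `c ≤ 3, k ≤ 4` (scratch/check_henon_average.py, 102 random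
  instances, 0 failures).
* `stub_meanThresholdSampler` (complexity, generic, M–L; TRUE — textbook "BPP estimates averages"): for every
  `V ∈ FP` with outputs of bounded LENGTH `≤ B`, every seed polynomial `q` and integer thresholds `tN < tY`, the promise
  problem "the mean of `|V ⟨x, r⟩|` over `r ∈ {0,1}^{q(|x|)}` is `≥ tY`" vs "`≤ tN`" is in `PromiseBPP'`: take
  `N = O(B²/(tY − tN)²)` independent seeds from the coins, sum the output lengths, compare with `N (tN + tY)/2`
  (Hoeffding; the tree has the counting forms `card_upperDeviation_sum_le_exp` / `BPPAmp.uniformProb_nbad_ge_le` and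
  the compilation lemma `PromiseProblem.mem_PromiseBPP'_of_fp_decider`). The statistic is read through `List.length`
  (the tree's unary-counter idiom, cf. `HeavyEnum`: `C = |cF params|`), so no output decoding is involved.
* `stub_polysignStatistic` (problem-specific plumbing, L; TRUE given the definitions): there is such a statistic
  `V ∈ FP` whose seed-mean separates the AVERAGE-FORM promise: on `encode I` with seed `r` (first `c` bits ↦
  `s ∈ ℤ/2^c`; `|encode I| ≥ c` because `c` is unary, so `q = X` suffices) output a string of length
  `round(D · (1 + Re~ henonTerm(I, s)))`, `Re~` = the real part quantised to `± 1/12` from the top `O(1)` bits of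
  `Φ(ã(s)) mod 4^c` (a fixed finite cosine table) — poly-time because `c` is unary (arithmetic mod `4^c` on
  `O(c)`-bit numbers, `k·deg` ring operations for the recurrence and the phase); then YES (`Re avg ≥ 1/3`) gives
  mean `≥ D(1 + 1/3 − 1/12)` and NO gives `≤ D(1 − 1/3 + 1/12)`.
* Composition (sorry-free, this file): `stub_henonAverage` rewrites POLYSIGN's yes/no sets into the average form
  (`yesSet_eq_yesAvg`, `noSet_eq_noAvg`); `stub_polysignStatistic` embeds the average-form promise into a mean-threshold
  promise, which `stub_meanThresholdSampler` puts in `PromiseBPP'`; `PromiseBPP'` is monotone under shrinking the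
  promise (`mem_PromiseBPP'_of_subset`). `TspSignInPrBPP_of : Sig.stub_henonAverage → Sig.stub_meanThresholdSampler →
  Sig.stub_polysignStatistic → TspSignInPrBPP` concludes the route decl BY NAME; `TspSignInPrBPP_proof` is the skeleton in its
  final shape (depends on `sorryAx` only through the three `stub_*`).

## Disproof / negatives used

`Cruxes/TspSignInPrBPP/` had no workfiles before this one (`ledger crux ls stmt-QuantumAdvantage-2646`, 2026-08-17:
no `Disproof.lean`, no ideas, no dead lines); none of the 6 entries of `ledger negatives --problem QuantumAdvantage`
concerns chain sums, promise-BPP samplers or POLYSIGN. The item's refuter/grounder notes (2026-08-15) are honoured: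
the only doubted part of the crux "as TYPED" is the `PromiseBPP'` plumbing (c UNARY, nested `pairBool/listBool`
decoding in `FP`) — isolated here as `stub_polysignStatistic`; the number theory is `stub_henonAverage` with the
vendored engine named.

## BC3 audit (this seat; raw outputs in the seat's NOTES.md `birth-certificate:`)

`lean check --json` rc 0 with `sorry` exactly in `stub_henonAverage`, `stub_meanThresholdSampler`,
`stub_polysignStatistic` (sorry count 3 = stub count, zero elsewhere); probes `stub → TspSignInPrBPP`,
`stub → ¬ QuantumAdvantage` (the route's side of the sub-problem) and `stub → QuantumAdvantage` by
`first | exact? | simpa [stub] | (unfold stub; simpa) | aesop` FAIL for all three stubs (9/9), files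
`bc/TspSignInPrBPP_probe_<stub>_<target>.lean` of the seat folder.
-/

set_option linter.dupNamespace false
set_option linter.unusedVariables false

noncomputable section

namespace Summit.QuantumAdvantage.QuantumAdvantage.Cruxes.TspSignInPrBPP.Birth

open _root_.Computability
open Literature.Computability.Complexity
open Summit.QuantumAdvantage.QuantumAdvantage.Theses.TwoAdicStationaryPhase

/-! ## The chain sum in general variables (verbatim sub-terms of the route decls `TspAmplitudeAverage` etc.) -/

/-- The normalised chain sum `A = (2^c)^{-(k+1)} Σ_{v ∈ (ℤ/4^c)^k} e(Φ(v)/4^c)`, `Φ(v) = Σ_{i ≤ k} P_i(w_i) + w_i w_{i+1}`,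
`w = (x, v, y)` — verbatim the left-hand side of the route's `TspAmplitudeAverage` (i) (= the amplitude
`⟨y| F D_{P_k} ⋯ F D_{P_0} |x⟩`, tree `PolyPhaseCircuit.amplitude_chain`). [folklore] -/
def amp (c k : ℕ) (P : Fin (k + 1) → Polynomial ℤ) (x y : ℤ) : ℂ :=
  (((2 : ℂ) ^ c)⁻¹ ^ (k + 1) * (∑ v : Fin k → ZMod (4 ^ c), Complex.exp (2 * Real.pi * Complex.I * ((((∑ i : Fin (k + 1), (((P i).map (Int.castRingHom (ZMod (4 ^ c)))).eval ((Fin.cons ↑x (Fin.snoc v ↑y) : Fin (k + 2) → ZMod (4 ^ c)) i.castSucc) + (Fin.cons ↑x (Fin.snoc v ↑y) : Fin (k + 2) → ZMod (4 ^ c)) i.castSucc * (Fin.cons ↑x (Fin.snoc v ↑y) : Fin (k + 2) → ZMod (4 ^ c)) i.succ))).val : ℂ) / (4 ^ c : ℂ)))))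

/-- Criticality of `a ∈ (ℤ/2^c)^k` (verbatim the predicate of the route decls): for every `j < k`,
`P'_{j+1}(a_j) + w_j + w_{j+2} = 0` in `ℤ/2^c`, `w = (x, a, y)` — i.e. `∇Φ(a) ≡ 0 (mod 2^c)`. [folklore] -/
def Crit (c k : ℕ) (P : Fin (k + 1) → Polynomial ℤ) (x y : ℤ) (a : Fin k → ZMod (2 ^ c)) : Prop :=
  ∀ j : Fin k, ((Polynomial.derivative (P j.succ)).map (Int.castRingHom (ZMod (2 ^ c)))).eval ((Fin.cons ↑x (Fin.snoc a ↑y) : Fin (k + 2) → ZMod (2 ^ c)) j.castSucc.succ) + (Fin.cons ↑x (Fin.snoc a ↑y) : Fin (k + 2) → ZMod (2 ^ c)) j.castSucc.castSucc + (Fin.cons ↑x (Fin.snoc a ↑y) : Fin (k + 2) → ZMod (2 ^ c)) j.succ.succ = 0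

instance Crit.instDecidable (c k : ℕ) (P : Fin (k + 1) → Polynomial ℤ) (x y : ℤ) (a : Fin k → ZMod (2 ^ c)) :
    Decidable (Crit c k P x y a) := by
  unfold Crit; infer_instance

/-- The phase term `e(Φ(ã)/4^c)` at the least-residue lift `ã` of `a ∈ (ℤ/2^c)^k` (verbatim the summand of the
right-hand side of the route's `TspAmplitudeAverage` (i)). [folklore] -/
def critPhase (c k : ℕ) (P : Fin (k + 1) → Polynomial ℤ) (x y : ℤ) (a : Fin k → ZMod (2 ^ c)) : ℂ :=
  Complex.exp (2 * Real.pi * Complex.I * ((((∑ i : Fin (k + 1), (((P i).map (Int.castRingHom (ZMod (4 ^ c)))).eval ((Fin.cons ↑x (Fin.snoc (fun i => (((a i).val : ℕ) : ZMod (4 ^ c))) ↑y) : Fin (k + 2) → ZMod (4 ^ c)) i.castSucc) + (Fin.cons ↑x (Fin.snoc (fun i => (((a i).val : ℕ) : ZMod (4 ^ c))) ↑y) : Fin (k + 2) → ZMod (4 ^ c)) i.castSucc * (Fin.cons ↑x (Fin.snoc (fun i => (((a i).val : ℕ) : ZMod (4 ^ c))) ↑y) : Fin (k + 2) → ZMod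 (4 ^ c)) i.succ))).val : ℂ) / (4 ^ c : ℂ)))

/-! ## The Hénon skeleton chain (the card's (T): critical points are skeleton trajectories) -/

/-- The kicks extended by `0` beyond index `k` (so that the recurrence is total in `n : ℕ`). [folklore] -/
def kickExt (k : ℕ) (P : Fin (k + 1) → Polynomial ℤ) (n : ℕ) : Polynomial ℤ :=
  if h : n < k + 1 then P ⟨n, h⟩ else 0

/-- The pair `(W'_n, W'_{n+1})` of the HÉNON SKELETON TRAJECTORY in `ℤ/2^c` started at `(W'_0, W'_1) = (x, s)`:
`W'_{n+2} = -W'_n - P'_{n+1}(W'_{n+1})` — the `j = n` criticality equation `P'_{n+1}(w_{n+1}) + w_n + w_{n+2} = 0`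
solved for `w_{n+2}` (generalised Hénon map `(u, v) ↦ (v, -u - P'(v))`, Jacobian `1`). [folklore] -/
def chainPair (c k : ℕ) (P : Fin (k + 1) → Polynomial ℤ) (x : ℤ) (s : ZMod (2 ^ c)) : ℕ → ZMod (2 ^ c) × ZMod (2 ^ c)
  | 0 => ((x : ZMod (2 ^ c)), s)
  | n + 1 => ((chainPair c k P x s n).2,
      -(chainPair c k P x s n).1 -
        ((Polynomial.derivative (kickExt k P (n + 1))).map (Int.castRingHom (ZMod (2 ^ c)))).eval (chainPair c k P x s n).2)

/-- The chain `a(s) = (W'_1, …, W'_k) ∈ (ℤ/2^c)^k` from the first path variable `a_0 = s`. [folklore] -/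
def chain (c k : ℕ) (P : Fin (k + 1) → Polynomial ℤ) (x : ℤ) (s : ZMod (2 ^ c)) : Fin k → ZMod (2 ^ c) :=
  fun i => (chainPair c k P x s (i : ℕ)).2

/-- First coordinate of `a ∈ (ℤ/2^c)^k`, or `0` when `k = 0`. [folklore] -/
def headD (c k : ℕ) (a : Fin k → ZMod (2 ^ c)) : ZMod (2 ^ c) :=
  if h : 0 < k then a ⟨0, h⟩ else 0

/-- THE SAMPLE TERM `f(s) ∈ {0} ∪ U(1)`: `e(Φ(ã(s))/4^c)` if the chain from `s` is critical (for `k ≥ 1` only the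
closing equation `P'_k(a_{k-1}) + w_{k-1} + y = 0` is not automatic) and starts at `s` (automatic for `k ≥ 1`; for
`k = 0` the guard reads `s = 0`, so that exactly one sample carries the single term), else `0`. [folklore] -/
def henonTerm (c k : ℕ) (P : Fin (k + 1) → Polynomial ℤ) (x y : ℤ) (s : ZMod (2 ^ c)) : ℂ :=
  if headD c k (chain c k P x s) = s ∧ Crit c k P x y (chain c k P x s) then critPhase c k P x y (chain c k P x s)
  else 0

/-- The AVERAGE FORM `2^{-c} Σ_{s ∈ ℤ/2^c} f(s)` of the amplitude. [folklore] -/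
def henonAvg (c k : ℕ) (P : Fin (k + 1) → Polynomial ℤ) (x y : ℤ) : ℂ :=
  ((2 : ℂ) ^ c)⁻¹ * ∑ s : ZMod (2 ^ c), henonTerm c k P x y s

/-- `|e(n/4^c)| = 1` in the literal form of the route statements. [folklore] -/
theorem norm_exp_chainPhase_eq_one (n c : ℕ) :
    ‖Complex.exp (2 * Real.pi * Complex.I * (((n : ℕ) : ℂ) / (4 ^ c : ℂ)))‖ = 1 := by
  have h : (2 * Real.pi * Complex.I * (((n : ℕ) : ℂ) / (4 ^ c : ℂ)) : ℂ) =
      ((2 * Real.pi * ((n : ℝ) / (4 : ℝ) ^ c) : ℝ) : ℂ) * Complex.I := by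
    push_cast; ring
  rw [h, Complex.norm_exp_ofReal_mul_I]

/-- Every sample term has modulus `≤ 1` (it is `0` or `e(Φ(ã)/4^c)`): `f(s) ∈ {0} ∪ U(1)`. [folklore] -/
theorem norm_henonTerm_le (c k : ℕ) (P : Fin (k + 1) → Polynomial ℤ) (x y : ℤ) (s : ZMod (2 ^ c)) :
    ‖henonTerm c k P x y s‖ ≤ 1 := by
  unfold henonTerm critPhase
  split_ifs
  · exact (norm_exp_chainPhase_eq_one _ c).le
  · simp

/-! ## POLYSIGN, named (verbatim sub-terms of the crux `TspSignInPrBPP`) -/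

/-- Instances `I = (c, x, y, P₀, [P₁, …, P_k])`. [folklore] -/
abbrev Inst : Type := ℕ × ℕ × ℕ × List ℕ × List (List ℕ)

/-- The Boolean encoding of instances (verbatim the one in the crux; `c` in UNARY). [folklore] -/
def instEnc : Encoding Inst Bool :=
  (Computability.unaryEncodingNat.pairBool (Computability.encodingNatBool.pairBool (Computability.encodingNatBool.pairBool (Computability.encodingNatBool.listBool.pairBool Computability.encodingNatBool.listBool.listBool))))

/-- The kicks of an instance as integer polynomials `P_i = Σ_j (coefficient list i)_j X^j`, `i ≤ k`
(verbatim the crux's inline lambda). [folklore] -/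
def kicks (I : Inst) : Fin (I.2.2.2.2.length + 1) → Polynomial ℤ :=
  (fun i : Fin (I.2.2.2.2.length + 1) => (∑ j ∈ Finset.range (((I.2.2.2.1 :: I.2.2.2.2).getD i.val [])).length, Polynomial.C (((((I.2.2.2.1 :: I.2.2.2.2).getD i.val [])).getD j 0 : ℕ) : ℤ) * Polynomial.X ^ j))

/-- The amplitude `A(I)` of the crux, verbatim. [folklore] -/
def ampI (I : Inst) : ℂ :=
  ((((2 : ℂ) ^ I.1)⁻¹ ^ (I.2.2.2.2.length + 1) * (∑ v : Fin I.2.2.2.2.length → ZMod (4 ^ I.1), Complex.exp (2 * Real.pi * Complex.I * ((((∑ i : Fin (I.2.2.2.2.length + 1), ((((fun i : Fin (I.2.2.2.2.length + 1) => (∑ j ∈ Finset.range (((I.2.2.2.1 :: I.2.2.2.2).getD i.val [])).length, Polynomial.C (((((I.2.2.2.1 :: I.2.2.2.2).getD i.val [])).getD j 0 : ℕ) : ℤ) * Polynomial.X ^ j)) i).map (Int.castRingHom (ZMod (4 ^ I.1)))).eval ((Fin.cons (((I.2.1 : ℤ) : ℤ) : ZMod (4 ^ I.1)) (Fin.snoc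 v (((I.2.2.1 : ℤ) : ℤ) : ZMod (4 ^ I.1))) : Fin (I.2.2.2.2.length + 2) → ZMod (4 ^ I.1)) i.castSucc) + (Fin.cons (((I.2.1 : ℤ) : ℤ) : ZMod (4 ^ I.1)) (Fin.snoc v (((I.2.2.1 : ℤ) : ℤ) : ZMod (4 ^ I.1))) : Fin (I.2.2.2.2.length + 2) → ZMod (4 ^ I.1)) i.castSucc * (Fin.cons (((I.2.1 : ℤ) : ℤ) : ZMod (4 ^ I.1)) (Fin.snoc v (((I.2.2.1 : ℤ) : ℤ) : ZMod (4 ^ I.1))) : Fin (I.2.2.2.2.length + 2) → ZMod (4 ^ I.1)) i.succ))).val : ℂ) / (4 ^ I.1 : ℂ))))))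

/-- `A(I)` is the general chain sum at the instance's data (definitional). [folklore] -/
theorem ampI_eq (I : Inst) : ampI I = amp I.1 I.2.2.2.2.length (kicks I) (I.2.1 : ℤ) (I.2.2.1 : ℤ) := rfl

/-- YES instances of POLYSIGN: `1/3 ≤ Re A(I)` (verbatim). [folklore] -/
def yesSet : Set Inst := {I | (1 : ℝ) / 3 ≤ (ampI I).re}

/-- NO instances of POLYSIGN: `Re A(I) ≤ -1/3` (verbatim). [folklore] -/
def noSet : Set Inst := {I | (ampI I).re ≤ -((1 : ℝ) / 3)}

/-- POLYSIGN as a promise problem over `{0,1}` (verbatim the crux's problem). [folklore] -/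
def polysign : PromiseProblem := PromiseProblem.ofEncoding instEnc yesSet noSet

/-- The crux, unfolded: `TspSignInPrBPP ↔ polysign ∈ PromiseBPP'` (definitional). [folklore] -/
theorem tspSignInPrBPP_iff :
    Summit.QuantumAdvantage.QuantumAdvantage.Theses.TwoAdicStationaryPhase.TspSignInPrBPP ↔
      polysign ∈ PromiseBPP' :=
  Iff.rfl

/-- The average-form quantity `2^{-c} Σ_s f_I(s)` of an instance. [folklore] -/
def avgI (I : Inst) : ℂ := henonAvg I.1 I.2.2.2.2.length (kicks I) (I.2.1 : ℤ) (I.2.2.1 : ℤ)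

/-- YES instances in average form. [folklore] -/
def yesAvg : Set Inst := {I | (1 : ℝ) / 3 ≤ (avgI I).re}

/-- NO instances in average form. [folklore] -/
def noAvg : Set Inst := {I | (avgI I).re ≤ -((1 : ℝ) / 3)}

/-! ## Mean-threshold promise problems of a bounded `FP` statistic -/

/-- The seed-mean of the LENGTH statistic of `V`: `𝔼_{r ∈ {0,1}^m} |V ⟨x, r⟩|` (counting over `List.Vector Bool m`,
the convention of the tree's `uniformProb`). [folklore] -/
def meanLen (V : List Bool → List Bool) (m : ℕ) (x : List Bool) : ℝ :=
  (∑ r : List.Vector Bool m, ((V (boolPair x r.toList)).length : ℝ)) / 2 ^ m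

/-- The mean-threshold promise problem of `(V, q, tN, tY)`: YES `tY ≤ 𝔼_{r ∈ {0,1}^{q(|x|)}} |V ⟨x, r⟩|`,
NO `𝔼 ≤ tN`. [folklore] -/
def meanProblem (V : List Bool → List Bool) (q : Polynomial ℕ) (tN tY : ℕ) : PromiseProblem where
  yes := {x : List Bool | (tY : ℝ) ≤ meanLen V (q.eval x.length) x}
  no := {x : List Bool | meanLen V (q.eval x.length) x ≤ (tN : ℝ)}

/-! ## The three stub statements, named `Sig.stub_*` (so that the hypothesis heads of `TspSignInPrBPP_of` carry the
registered stub names, as the skeleton audit requires) -/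

/-- **Stub 1 statement — HÉNON AVERAGE (number theory).** For all `c k P x y` the normalised chain sum is the exact
average of the sample terms over the first path variable: `A = 2^{-c} Σ_{s ∈ ℤ/2^c} henonTerm s`. [folklore] -/
def Sig.stub_henonAverage : Prop :=
  ∀ (c k : ℕ) (P : Fin (k + 1) → Polynomial ℤ) (x y : ℤ), amp c k P x y = henonAvg c k P x y

/-- **Stub 2 statement — MEAN-THRESHOLD SAMPLER (generic promise-BPP).** For every `V ∈ FP` with output lengths
`≤ B`, every seed polynomial `q` and thresholds `tN < tY`, `meanProblem V q tN tY ∈ PromiseBPP'`. [folklore] -/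
def Sig.stub_meanThresholdSampler : Prop :=
  ∀ (V : List Bool → List Bool) (q : Polynomial ℕ) (B tN tY : ℕ),
    V ∈ FP → (∀ z, (V z).length ≤ B) → tN < tY → meanProblem V q tN tY ∈ PromiseBPP'

/-- **Stub 3 statement — POLYSIGN STATISTIC (problem-specific `FP` plumbing).** Some bounded-length `V ∈ FP`, seed
polynomial `q` and thresholds `tN < tY` separate the AVERAGE-FORM promise by the seed-mean on encoded instances:
`tY ≤ mean` on `yesAvg`, `mean ≤ tN` on `noAvg`. [folklore] -/
def Sig.stub_polysignStatistic : Prop :=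
  ∃ (V : List Bool → List Bool) (q : Polynomial ℕ) (B tN tY : ℕ),
    V ∈ FP ∧ (∀ z, (V z).length ≤ B) ∧ tN < tY ∧
    (∀ I ∈ yesAvg, (tY : ℝ) ≤ meanLen V (q.eval (instEnc.encode I).length) (instEnc.encode I)) ∧
    (∀ I ∈ noAvg, meanLen V (q.eval (instEnc.encode I).length) (instEnc.encode I) ≤ (tN : ℝ))

/-! ## The three registered stubs -/

/-- **STUB 1 (M–L, TRUE on paper; numerically verified `c ≤ 3, k ≤ 4`): Hénon average.** Proof route:
`TspChainLocalisation` (= Dąbrowski–Fisher 1997 Thm 1.8(a), `p = 2`, `m = 2c`; tree fact PROVED: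
`Literature.NumberTheory.GaussSums.DabrowskiFisher1997_even_holds`, `…_fibre_eq_zero_holds`) gives
`A = 2^{-c} Σ_{a critical} e(Φ(ã)/4^c)` (`TspAmplitudeAverage` (i)); a critical `a` satisfies the recurrence of
`chainPair`, hence `a = chain (a 0)` (strong induction on the index; `TspChainInjective`), so `a ↦ a 0` is a bijection
from critical points onto `{s | Crit (chain s)}` with inverse `chain` and `headD (chain s) = s` (`k ≥ 1`);
`Finset.sum_bij`. `k = 0`: both sides are the single term. Why it might fail: only by a convention slip (it must hold
at `c = 0`, `k = 0`, with `ZMod.val` lifts) — re-checked numerically in exactly this form. Leans on: Mathlib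
(`ZMod`, `Finset.sum_bij`, `Fin.cons/snoc`), the two tree facts above. Sources: DabrowskiFisher1997 (Thm 1.8(a)
p. 10), Fisher2002, KociaLove2021 (§5 Thm 1), arXiv:1810.03622. -/
theorem stub_henonAverage : Sig.stub_henonAverage := by
  sorry

/-- **STUB 2 (M–L, TRUE — textbook): mean-threshold sampler.** On `⟨x, y⟩` with `|y| = N · q(|x|)`
(`N = ⌈18 B² / (tY − tN)²⌉ + 1`, a constant) cut `y` into `N` seeds, run `V` on each `⟨x, rᵢ⟩`, add the output
lengths, accept iff `2 Σᵢ |V ⟨x, rᵢ⟩| ≥ N (tN + tY)`; this is a one-bit `FP` decider (tree `FP` algebra: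
`iterate_mem_FP`, `pairFn`, `truncSndFn`, `dropSndFn`, length counters as in `PromiseAmp`), and Hoeffding for
`[0, B]`-valued i.i.d. samples (tree `card_upperDeviation_sum_le_exp`, `card_deviation_le_exp`) bounds both error
probabilities by `1/3`; conclude with `PromiseProblem.mem_PromiseBPP'_of_fp_decider`. Why it might fail: it does
not mathematically; the Lean cost is the block-splitting machine (pattern: `PromiseBPPAmplification.lean`).
Sources: Hoeffding1963 (Thm 2), AroraBarakCC2009 (§7.4.1, Thm 7.10, Def 7.3), GoldreichPromise2006 (Def 1.2). -/
theorem stub_meanThresholdSampler : Sig.stub_meanThresholdSampler := by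
  sorry

/-- **STUB 3 (L, TRUE — problem-specific plumbing): the POLYSIGN statistic.** Witness: `q = X` (the seed has
`|encode I| ≥ c` bits since `c` is unary), `B = 2D`, `D = 24`, `tY = 30 = D(1 + 1/3 − 1/12)`,
`tN = 18 = D(1 − 1/3 + 1/12)`; `V ⟨x, r⟩`: decode `I` from `x` (nested `boolUnpair`, unary `c`, `encodingNatBool`
lists — all `FP`, cf. `Brick` algebra), read `s ∈ ℤ/2^c` off the first `c` bits of `r`, run the recurrence
`chainPair` mod `2^c` (least residues, `k` steps of `O(deg)` ring operations on `O(c)`-bit numbers), test `Crit` and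
the head guard, compute `Φ(ã) mod 4^c`, and output `D + round(D · cos~)` symbols where `cos~` is `cos(2π m/4^c)`
quantised from the top 7 bits of `m = Φ(ã).val` through a fixed 128-entry dyadic table (error `≤ 2π/128 + 2^{-8} <
1/12`), or `D` symbols (value `0`) when the guard fails. Then `mean = D (1 + 𝔼_s Re~ f(s))` with
`|Re~ f − Re f| ≤ 1/12`, and `𝔼_s Re f(s) = Re avgI(I)` (uniform marginal of the first `c` seed bits;
`(Fin c → Bool) ≃ ZMod (2^c)` by binary value). Why it might fail: as the crux "as typed" — only in the plumbing
(a hidden non-polynomial step if `c` were binary; it is unary). Leans on: tree `FP` closure algebra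
(`BrickAlgebra`, `PromiseCookMachine`), `exists_poly_length_le_of_mem_FP`, Mathlib `Real.cos` bounds for the table.
Sources: AroraBarakCC2009 (§7, Def 7.3), GoldreichPromise2006, Vandennest2011 (bounded estimators), KociaLove2021. -/
theorem stub_polysignStatistic : Sig.stub_polysignStatistic := by
  sorry

/-! ## Sorry-free composition -/

/-- Textbook promise-BPP is monotone under shrinking the promise. [Goldreich 2006, §1.2] [folklore] -/
theorem mem_PromiseBPP'_of_subset {Q Q' : PromiseProblem} (hy : Q'.yes ≤ Q.yes) (hn : Q'.no ≤ Q.no)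
    (h : Q ∈ PromiseBPP') : Q' ∈ PromiseBPP' := by
  obtain ⟨L', hL', p, hyes, hno⟩ := h
  exact ⟨L', hL', p, fun x hx => hyes x (hy hx), fun x hx => hno x (hn hx)⟩

/-- Stub 1 turns POLYSIGN's YES set into its average form. [folklore] -/
theorem yesSet_eq_yesAvg (h₁ : Sig.stub_henonAverage) : yesSet = yesAvg := by
  unfold Sig.stub_henonAverage at h₁
  ext I
  simp only [yesSet, yesAvg, Set.mem_setOf_eq, ampI_eq, avgI, h₁]

/-- Stub 1 turns POLYSIGN's NO set into its average form. [folklore] -/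
theorem noSet_eq_noAvg (h₁ : Sig.stub_henonAverage) : noSet = noAvg := by
  unfold Sig.stub_henonAverage at h₁
  ext I
  simp only [noSet, noAvg, Set.mem_setOf_eq, ampI_eq, avgI, h₁]

/-- Stubs 2 and 3 put the average-form promise problem in `PromiseBPP'`. [folklore] -/
theorem polysignAvg_mem (h₂ : Sig.stub_meanThresholdSampler) (h₃ : Sig.stub_polysignStatistic) :
    PromiseProblem.ofEncoding instEnc yesAvg noAvg ∈ PromiseBPP' := by
  obtain ⟨V, q, B, tN, tY, hV, hB, hlt, hyes, hno⟩ := h₃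
  refine mem_PromiseBPP'_of_subset ?_ ?_ (h₂ V q B tN tY hV hB hlt)
  · rintro z ⟨I, hI, rfl⟩
    exact hyes I hI
  · rintro z ⟨I, hI, rfl⟩
    exact hno I hI

/-- **The real composition.** From the three stub statements (as hypotheses) the crux follows BY NAME: unfold the
crux to `polysign ∈ PromiseBPP'`, rewrite the yes/no sets into average form with stub 1, and apply
`polysignAvg_mem`. [folklore] -/
theorem TspSignInPrBPP_of : Sig.stub_henonAverage → Sig.stub_meanThresholdSampler → Sig.stub_polysignStatistic →
    Summit.QuantumAdvantage.QuantumAdvantage.Theses.TwoAdicStationaryPhase.TspSignInPrBPP := by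
  intro h₁ h₂ h₃
  rw [tspSignInPrBPP_iff]
  unfold polysign
  rw [yesSet_eq_yesAvg h₁, noSet_eq_noAvg h₁]
  exact polysignAvg_mem h₂ h₃

/-- **THE skeleton theorem** — the crux `TspSignInPrBPP` BY NAME from the three registered stubs (`sorry` enters only
through `stub_henonAverage`, `stub_meanThresholdSampler`, `stub_polysignStatistic`). [folklore] -/
theorem TspSignInPrBPP_proof :
    Summit.QuantumAdvantage.QuantumAdvantage.Theses.TwoAdicStationaryPhase.TspSignInPrBPP :=
  TspSignInPrBPP_of stub_henonAverage stub_meanThresholdSampler stub_polysignStatistic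

end Summit.QuantumAdvantage.QuantumAdvantage.Cruxes.TspSignInPrBPP.Birth

end
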